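import Literature.Analysis.SpecialFunctions.LogFactorialRobbins
import Mathlib.Analysis.SpecialFunctions.Log.NegMulLog
import HarnessLib

/-!
# Entropy form of `log C(m, k)` with Stirling's prefactor

* `choose_le_exp_entropy` — `C(m,k) ≤ exp(m log m - k log k - (m-k) log(m-k))` (all `k ≤ m`);
* `log_choose_eq_stirling` — for `0 < k < m`,
  `log C(m,k) = [m log m - k log k - (m-k) log (m-k)] + ½ log(m/(2π k (m-k))) + θ` with
  `-(1/(12k) + 1/(12(m-k))) ≤ θ ≤ 1/(12m)` (Robbins' bounds, file `LogFactorialRobbins`);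
* `log_choose_ge_entropy` — the crude lower bound `log C(m,k) ≥ [entropy] - (log m)/2 - 2`;
* `entropy_eq_mul_scaled` — `m log m - k log k - (m-k) log(m-k) = N (X log X - Y log Y - (X-Y) log (X-Y))`
  for `X = m/N`, `Y = k/N`.

Folklore; theorems only.
-/

noncomputable section

open Real Finset

namespace Literature.Analysis.SpecialFunctions

/-- **Entropy bound for binomial coefficients**: `C(m,k) (k/m)^k (1-k/m)^{m-k} ≤ 1`, i.e.
`log C(m,k) ≤ m log m - k log k - (m-k) log(m-k)`, for all `k ≤ m`. [folklore] -/
theorem log_choose_le_entropy {m k : ℕ} (hkm : k ≤ m) :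
    Real.log (m.choose k) ≤ m * Real.log m - k * Real.log k - (m - k : ℝ) * Real.log (m - k : ℝ) := by
  rcases Nat.eq_zero_or_pos k with rfl | hk
  · simp
  rcases eq_or_lt_of_le hkm with rfl | hlt
  · simp
  have hm : (0 : ℝ) < m := by exact_mod_cast lt_of_lt_of_le hk hkm
  have hkR : (0 : ℝ) < k := by exact_mod_cast hk
  have hmk : (0 : ℝ) < (m : ℝ) - k := by
    have : (k : ℝ) < m := by exact_mod_cast hlt
    linarith
  set p : ℝ := k / m with hp
  have hp0 : 0 < p := div_pos hkR hm
  have hp1 : p < 1 := (div_lt_one hm).mpr (by exact_mod_cast hlt)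
  -- the `k`-th term of `(p + (1-p))^m = 1`
  have hsum := add_pow p (1 - p) m
  rw [add_sub_cancel, one_pow] at hsum
  have hterm : (m.choose k : ℝ) * (p ^ k * (1 - p) ^ (m - k)) ≤ 1 := by
    have hle := Finset.single_le_sum (s := range (m + 1)) (a := k)
      (f := fun j => p ^ j * (1 - p) ^ (m - j) * (m.choose j : ℝ))
      (fun j _ => by positivity) (mem_range.mpr (Nat.lt_succ_of_le hkm))
    rw [← hsum] at hle
    linarith [hle]
  have hpos : 0 < p ^ k * (1 - p) ^ (m - k) := by
    have : 0 < 1 - p := by linarith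
    positivity
  have hC : (m.choose k : ℝ) ≤ (p ^ k * (1 - p) ^ (m - k))⁻¹ := by
    rw [← one_div]
    exact (le_div_iff₀ hpos).mpr hterm
  have hlog := Real.log_le_log (by exact_mod_cast Nat.choose_pos hkm) hC
  rw [Real.log_inv, Real.log_mul (pow_pos hp0 _).ne' (pow_pos (by linarith) _).ne', Real.log_pow,
    Real.log_pow, Nat.cast_sub hkm, hp, Real.log_div hkR.ne' hm.ne',
    show (1 : ℝ) - k / m = (m - k) / m by field_simp, Real.log_div hmk.ne' hm.ne'] at hlog
  have : (k : ℝ) * Real.log m + ((m : ℝ) - k) * Real.log m = m * Real.log m := by ring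
  linarith

/-- **`log C(m,k)` with Stirling's prefactor** (Robbins): for `0 < k < m`,
`log C(m,k) = [m log m - k log k - (m-k) log(m-k)] + ½ (log m - log k - log(m-k) - log 2π) + θ`
with `-(1/(12k) + 1/(12(m-k))) ≤ θ ≤ 1/(12m)`. [folklore] -/
theorem log_choose_eq_stirling {m k : ℕ} (hk : 0 < k) (hkm : k < m) :
    ∃ θ : ℝ, -(1 / (12 * (k : ℝ)) + 1 / (12 * ((m : ℝ) - k))) ≤ θ ∧ θ ≤ 1 / (12 * (m : ℝ)) ∧
      Real.log (m.choose k) =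
        (m * Real.log m - k * Real.log k - (m - k : ℝ) * Real.log (m - k : ℝ)) +
          (Real.log m - Real.log k - Real.log (m - k : ℝ) - Real.log (2 * π)) / 2 + θ := by
  have hm0 : m ≠ 0 := by omega
  have hk0 : k ≠ 0 := by omega
  have hmk0 : m - k ≠ 0 := by omega
  obtain ⟨l1, u1⟩ := abs_log_factorial_sub_stirling_le hm0
  obtain ⟨l2, u2⟩ := abs_log_factorial_sub_stirling_le hk0
  obtain ⟨l3, u3⟩ := abs_log_factorial_sub_stirling_le hmk0
  have hcast : ((m - k : ℕ) : ℝ) = (m : ℝ) - k := Nat.cast_sub hkm.le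
  rw [hcast] at l3 u3
  have hm : (0 : ℝ) < m := by exact_mod_cast Nat.pos_of_ne_zero hm0
  have hkR : (0 : ℝ) < k := by exact_mod_cast hk
  have hmk : (0 : ℝ) < (m : ℝ) - k := by
    have : (k : ℝ) < m := by exact_mod_cast hkm
    linarith
  -- `log C = log m! - log k! - log (m-k)!`
  have hC : Real.log (m.choose k) =
      Real.log (m.factorial) - Real.log (k.factorial) - Real.log ((m - k).factorial) := by
    have h := Nat.choose_mul_factorial_mul_factorial hkm.le
    have h' : (m.choose k : ℝ) * (k.factorial : ℝ) * ((m - k).factorial : ℝ) = (m.factorial : ℝ) := by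
      exact_mod_cast h
    have h1 : (0 : ℝ) < k.factorial := by exact_mod_cast Nat.factorial_pos _
    have h2 : (0 : ℝ) < (m - k).factorial := by exact_mod_cast Nat.factorial_pos _
    have h3 : (0 : ℝ) < m.choose k := by exact_mod_cast Nat.choose_pos hkm.le
    rw [← h', Real.log_mul (by positivity) h2.ne', Real.log_mul h3.ne' h1.ne']
    ring
  refine ⟨Real.log (m.choose k) -
      ((m * Real.log m - k * Real.log k - (m - k : ℝ) * Real.log (m - k : ℝ)) +
        (Real.log m - Real.log k - Real.log (m - k : ℝ) - Real.log (2 * π)) / 2), ?_, ?_, by ring⟩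
  · rw [hC]
    have e1 : Real.log (2 * π * m) = Real.log (2 * π) + Real.log m :=
      Real.log_mul (by positivity) hm.ne'
    have e2 : Real.log (2 * π * k) = Real.log (2 * π) + Real.log k :=
      Real.log_mul (by positivity) hkR.ne'
    have e3 : Real.log (2 * π * ((m : ℝ) - k)) = Real.log (2 * π) + Real.log ((m : ℝ) - k) :=
      Real.log_mul (by positivity) hmk.ne'
    rw [e1] at l1 u1
    rw [e2] at l2 u2
    rw [e3] at l3 u3
    linarith
  · rw [hC]
    have e1 : Real.log (2 * π * m) = Real.log (2 * π) + Real.log m :=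
      Real.log_mul (by positivity) hm.ne'
    have e2 : Real.log (2 * π * k) = Real.log (2 * π) + Real.log k :=
      Real.log_mul (by positivity) hkR.ne'
    have e3 : Real.log (2 * π * ((m : ℝ) - k)) = Real.log (2 * π) + Real.log ((m : ℝ) - k) :=
      Real.log_mul (by positivity) hmk.ne'
    rw [e1] at l1 u1
    rw [e2] at l2 u2
    rw [e3] at l3 u3
    linarith

/-- **Crude lower bound**: `log C(m,k) ≥ [m log m - k log k - (m-k) log(m-k)] - (log m)/2 - 2` for
`k ≤ m`, `1 ≤ m`. [folklore] -/
theorem log_choose_ge_entropy {m k : ℕ} (hm1 : 1 ≤ m) (hkm : k ≤ m) :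
    (m * Real.log m - k * Real.log k - (m - k : ℝ) * Real.log (m - k : ℝ)) - Real.log m / 2 - 2 ≤
      Real.log (m.choose k) := by
  have hm : (0 : ℝ) < m := by exact_mod_cast hm1
  have hlogm : 0 ≤ Real.log m := Real.log_nonneg (by exact_mod_cast hm1)
  rcases Nat.eq_zero_or_pos k with rfl | hk
  · simp; linarith
  rcases eq_or_lt_of_le hkm with rfl | hlt
  · simp; linarith
  obtain ⟨θ, hθl, -, hθ⟩ := log_choose_eq_stirling hk hlt
  have hkR : (1 : ℝ) ≤ k := by exact_mod_cast hk
  have hmk : (1 : ℝ) ≤ (m : ℝ) - k := by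
    have : k + 1 ≤ m := hlt
    have : ((k : ℝ) + 1) ≤ m := by exact_mod_cast this
    linarith
  -- `log k + log (m-k) ≤ 2 log m`, `log 2π ≤ 2`, `θ ≥ -1/6`
  have h1 : Real.log k ≤ Real.log m := Real.log_le_log (by linarith) (by exact_mod_cast hkm)
  have h2 : Real.log ((m : ℝ) - k) ≤ Real.log m := Real.log_le_log (by linarith) (by linarith)
  have h3 : Real.log (2 * π) ≤ 3 := by
    have h8 : 2 * π ≤ 8 := by linarith [Real.pi_le_four]
    have hlog2 : Real.log 2 ≤ 1 := by
      have h2e : (2 : ℝ) ≤ Real.exp 1 := by linarith [Real.add_one_le_exp (1 : ℝ)]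
      calc Real.log 2 ≤ Real.log (Real.exp 1) := Real.log_le_log (by norm_num) h2e
        _ = 1 := Real.log_exp 1
    calc Real.log (2 * π) ≤ Real.log 8 := Real.log_le_log (by positivity) h8
      _ = 3 * Real.log 2 := by
        rw [show (8 : ℝ) = 2 ^ 3 by norm_num, Real.log_pow]; norm_num
      _ ≤ 3 := by linarith
  have h4 : -(1 / 6 : ℝ) ≤ θ := by
    have a1 : 1 / (12 * (k : ℝ)) ≤ 1 / 12 :=
      one_div_le_one_div_of_le (by norm_num) (by linarith)
    have a2 : 1 / (12 * ((m : ℝ) - k)) ≤ 1 / 12 :=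
      one_div_le_one_div_of_le (by norm_num) (by linarith)
    linarith
  rw [hθ]
  linarith

/-- **Scaling the entropy form**: for `N > 0`,
`m log m - k log k - (m-k) log(m-k) = N·(X log X - Y log Y - (X-Y) log(X-Y))` with `X = m/N`,
`Y = k/N` (the `log N` terms cancel). [folklore] -/
theorem entropy_eq_mul_scaled {N : ℝ} (hN : 0 < N) (m k : ℝ) :
    m * Real.log m - k * Real.log k - (m - k) * Real.log (m - k) =
      N * (m / N * Real.log (m / N) - k / N * Real.log (k / N) -
        (m / N - k / N) * Real.log (m / N - k / N)) := by
  have hN0 : N ≠ 0 := hN.ne'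
  have key : ∀ u : ℝ, u / N * Real.log (u / N) = (u * Real.log u - u * Real.log N) / N := by
    intro u
    by_cases hu : u = 0
    · simp [hu]
    · rw [Real.log_div hu hN0]; field_simp
  rw [← sub_div, key m, key k, key (m - k)]
  field_simp
  ring

end Literature.Analysis.SpecialFunctions
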